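import Summits.Parity.GeneralizedHardyLittlewood.Theorems.LeeYangFibresAssembly
import Summits.Parity.GeneralizedHardyLittlewood.Theorems.LeeYangFibresFibrationLemmaFinal
import HarnessLib

/-!
# Route `LeeYangFibres`: the fibration lemma and the item `Assembly` (stmt-Parity-14612), closed

The frame file `LeeYangFibresAssembly` reduces the route's item
`Assembly := CellParityLaw → FibreHyperbolicity → AbsoluteUpgrade → GeneralizedHardyLittlewood` to the
shared routine support `FibrationLemma : DimOne → GeneralizedHardyLittlewood` (stmt-Parity-0822;
`assembly_of_fibrationLemma`, the other three supports being theorems of the tree). The fibration lemma —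
Green–Tao's remark after Conjecture 1.2: the one-dimensional conjecture gives the conjecture in every
dimension "by holding `d − 1` of the variables fixed and summing in the remaining one" — is now proved in
the tree, Theses-free, as `FibrationGlue.generalizedHardyLittlewood_of_dimOne` (files
`LeeYangFibresFibrationLemma*`: fibring over the last coordinate, `DimOne` on the good fibres, averaging
of the fibre singular products via the periodicity of their heads and the `L¹`-smallness of their tails,
lift to non-zero last coefficients). This file specialises it to the route's copy of `DimOne`
(`leeYangFibres_fibrationLemma`) and closes the item (`leeYangFibres_assembly`).

References: B. Green, T. Tao, *Linear equations in primes*, Ann. of Math. 171 (2010), Conj. 1.2 and the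
remark following it [GreenTao2010].
-/

namespace Summit.Parity.GeneralizedHardyLittlewood.Theorems

/-- **The fibration lemma of route `LeeYangFibres`** (stmt-Parity-0822, shared support
`FibrationLemma : DimOne → GeneralizedHardyLittlewood`): the one-line specialisation of the Theses-free
fibration lemma `FibrationGlue.generalizedHardyLittlewood_of_dimOne` to this route's (verbatim) copy of
the one-dimensional conjecture `DimOne`. [cite: GreenTao2010, §1 (remark after Conj. 1.2)] -/
theorem leeYangFibres_fibrationLemma :
    Summit.Parity.GeneralizedHardyLittlewood.Theses.LeeYangFibres.FibrationLemma := fun hDim =>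
  FibrationGlue.generalizedHardyLittlewood_of_dimOne hDim

/-- **`Assembly` of route `LeeYangFibres`** (stmt-Parity-14612):
`CellParityLaw → FibreHyperbolicity → AbsoluteUpgrade → GeneralizedHardyLittlewood` — the route's two
mechanism cruxes and its declared residual imply the sub-problem Statement. All four routine supports
are theorems of the tree (`modelCellFacts_proof`, `HyperbolicityClipsParity_proof`,
`LeeYangFibresCells.cellsToRelativeDimOne_proof`, `leeYangFibres_fibrationLemma`), and `Assembly` is
their composition `fun hL hH hU => hF (hU (hD (hC hL hH hM)))`, exactly as in the deciding theorem
`closes` (`LeeYangFibresAssembly.assembly_of_fibrationLemma`).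
[cite: GreenTao2010, Conj. 1.2 and the remark following it] -/
theorem leeYangFibres_assembly :
    Summit.Parity.GeneralizedHardyLittlewood.Theses.LeeYangFibres.Assembly :=
  LeeYangFibresAssembly.assembly_of_fibrationLemma leeYangFibres_fibrationLemma

end Summit.Parity.GeneralizedHardyLittlewood.Theorems
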